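import Literature.NumberTheory.IwasawaTheory.FukudaGrowthStepFixedTorsion
import Literature.NumberTheory.IwasawaTheory.FukudaGrowthAlgebra
import HarnessLib

/-!
# The Fukuda growth step with an invariant non-square class of order two (the `−1` of Ferrero–Kida), group-theoretic form

Topic `NumberTheory/IwasawaTheory`; namespace `Literature.NumberTheory.IwasawaTheory.FukudaNakayama`.  Theorem-only file (no
definition, no named fact, no `sorry`), unconditional.

Setting (the top layer `T = K_{b+t}` of a `ℤ₂`-tower seen from `K_b`, abstracted): `B` a finite abelian group (`Cl(T)`), `g ∈ Aut B` with
`g^{2^t} = 1` (the action of a generator of `Gal(T/K_b)`), `c ∈ B` with `c² = 1`, `g c = c` and `c ∉ B²` (the class of the dyadic prime,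
Ferrero 1980 §3), `#B[2] = 2^r` with `1 ≤ r ≤ 2^{k₀}`, `k₀ + 1 ≤ k`.  For the «norm kernels» `H₁ ⊇ {g^{2^k}d/d}`-type subgroups we assume:
every `2`-primary element of `H₁` is `g^{2^k} d / d` with `d` `2`-primary (Washington's `ker N = (σ−1)A` in its `p`-primary form, tree
`forall_primary_eq_div_of_zpowers_eq_top`), and `H₂ ∋ g^{2^{k+1}} d / d` for all `d`.  THEN
**`ord₂ #H₁ ≤ ord₂ #H₂ + (r − 1)`** (`padicValNat_card_le_add_of_fixed_nonsquare`).

Proof: on the `2`-primary part `M = B[2^∞]` (written additively) with `φ =` the action of `g`, the tree's Fukuda step with the `φ`-fixed submodule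
`C = ℤc` (`card_range_pow_sub_one_le_mul`) gives `#Y_k ≤ #Y_{k+1} · #(M/(2M + ℤc))` for `Y_j = (φ^{2^j} − 1)M`, and `#(M/(2M + ℤc)) ≤ 2^{r−1}` since
`c ∉ 2M` (`card_quotient_sup_span_mul_le`); finally `#Y_k ≥ #H₁[2^∞] = 2^{ord₂ #H₁}` and `#Y_{k+1} ≤ #H₂[2^∞] = 2^{ord₂ #H₂}`.
This is the abstract core of the upper bound `λ₂ ≤ Σ − 1` in the Ferrero–Kida formula for `ℚ(√−d)`, `d ≡ 1 (mod 4)`.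

## References

* T. Fukuda, *Remarks on ℤ_p-extensions of number fields*, Proc. Japan Acad. 70 (1994) 264–266, Thm. 1 (proof). [Fukuda1994]
* L. C. Washington, *Introduction to Cyclotomic Fields*, GTM 83, Springer 1997, §13.3 (Lemma 13.15–13.18, Prop. 13.22–13.23). [Washington1997]
* B. Ferrero, *The cyclotomic ℤ₂-extension of imaginary quadratic fields*, Amer. J. Math. 102 (1980) 447–459, §3. [Ferrero1980AJM]
-/

noncomputable section

open Finset

namespace Literature.NumberTheory.IwasawaTheory.FukudaNakayama

/-! ## §1 Counting `p`-primary parts -/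

/-- `#B[p^k] = p^{v_p #B}` for `k ≥ v_p #B` (`B` finite commutative): the `p^k`-torsion is a `p`-group containing a Sylow `p`-subgroup (auxiliary).
[folklore] -/
private theorem card_ker_powMonoidHom_eq_pow_factorization {B : Type*} [CommGroup B] [Finite B] {p : ℕ} [hp : Fact p.Prime] {k : ℕ}
    (hk : (Nat.card B).factorization p ≤ k) :
    Nat.card ((powMonoidHom (p ^ k) : B →* B).ker) = p ^ (Nat.card B).factorization p := by
  classical
  obtain ⟨P⟩ : Nonempty (Sylow p B) := inferInstance
  have hP : Nat.card P = p ^ (Nat.card B).factorization p := P.card_eq_multiplicity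
  set T : Subgroup B := (powMonoidHom (p ^ k) : B →* B).ker with hTdef
  have hT : ∀ m, m ∈ T ↔ m ^ p ^ k = 1 := fun m => Iff.rfl
  have hPT : (P : Subgroup B) ≤ T := by
    intro x hx
    rw [hT, ← orderOf_dvd_iff_pow_eq_one]
    exact (Subgroup.orderOf_dvd_natCard (P : Subgroup B) hx).trans (hP ▸ pow_dvd_pow p hk)
  have hTp : IsPGroup p T := fun x => ⟨k, Subtype.ext ((hT x.1).mp x.2)⟩
  obtain ⟨n, hn⟩ := IsPGroup.iff_card.mp hTp
  have hdvd : p ^ n ∣ Nat.card B := hn ▸ Subgroup.card_subgroup_dvd_card T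
  have hn_le : n ≤ (Nat.card B).factorization p := (hp.out.pow_dvd_iff_le_factorization Nat.card_pos.ne').mp hdvd
  have hle : Nat.card P ≤ Nat.card T := Subgroup.card_le_of_le hPT
  rw [hP, hn] at hle
  have hge : (Nat.card B).factorization p ≤ n := (Nat.pow_le_pow_iff_right hp.out.one_lt).mp hle
  rw [hn, le_antisymm hn_le hge]

/-- `#(H ∩ B[p^k]) = p^{v_p #H}` for a subgroup `H` of the finite commutative group `B` and `k ≥ v_p #B` (auxiliary). [folklore] -/
private theorem card_inf_ker_powMonoidHom_eq {B : Type*} [CommGroup B] [Finite B] {p : ℕ} [hp : Fact p.Prime] {k : ℕ}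
    (hk : (Nat.card B).factorization p ≤ k) (H : Subgroup B) :
    Nat.card ↥(H ⊓ (powMonoidHom (p ^ k) : B →* B).ker) = p ^ (Nat.card H).factorization p := by
  have hkH : (Nat.card H).factorization p ≤ k := by
    refine le_trans ?_ hk
    exact (Nat.factorization_le_iff_dvd Nat.card_pos.ne' Nat.card_pos.ne').mpr (Subgroup.card_subgroup_dvd_card H) p
  rw [← card_ker_powMonoidHom_eq_pow_factorization hkH]
  refine Nat.card_congr
    { toFun := fun x => ⟨⟨x.1, (Subgroup.mem_inf.mp x.2).1⟩, ?_⟩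
      invFun := fun y => ⟨y.1.1, Subgroup.mem_inf.mpr ⟨y.1.2, ?_⟩⟩
      left_inv := fun x => rfl
      right_inv := fun y => rfl }
  · have h2 := (Subgroup.mem_inf.mp x.2).2
    rw [MonoidHom.mem_ker, powMonoidHom_apply] at h2 ⊢
    exact Subtype.ext (by rw [Subgroup.coe_pow]; exact h2)
  · have h2 := y.2
    rw [MonoidHom.mem_ker, powMonoidHom_apply] at h2 ⊢
    have := congrArg Subtype.val h2
    rwa [Subgroup.coe_pow] at this

/-! ## §2 The growth step with an invariant non-square class of order two -/

/-- ★ **Fukuda's growth step with an invariant non-square `2`-torsion class.**  `B` finite abelian, `g ∈ Aut B`, `g^{2^t} = 1`; `c ∈ B` with `c² = 1`, `g c = c`,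
`c ∉ B²`; `#B[2] = 2^r`, `1 ≤ r ≤ 2^{k₀}`, `k₀ + 1 ≤ k`; subgroups `H₁, H₂ ≤ B` with: every `2^{a}`-torsion element of `H₁` (`2^a ∥ #B`) is `g^{2^k}d/d` with `d^{2^a} = 1`, and
`g^{2^{k+1}}d/d ∈ H₂` for all `d`.  THEN `ord₂ #H₁ ≤ ord₂ #H₂ + (r − 1)`.  (In the `ℤ₂`-tower: `H_i = ker N_{T/K_{b+k+i−1}}`, so `e_{b+k+1} − e_{b+k} ≤ r − 1`.)
[cite: Fukuda1994, Thm. 1 (proof), p. 264] [cite: Washington1997, §13.3 Lemma 13.18 and Prop. 13.22–13.23] [cite: Ferrero1980AJM, §3] -/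
theorem padicValNat_card_le_add_of_fixed_nonsquare {B : Type*} [CommGroup B] [Finite B] (g : MulAut B) {t : ℕ} (hg : g ^ (2 ^ t) = 1)
    (c : B) (hc2 : c ^ 2 = 1) (hgc : g c = c) (hcsq : c ∉ (powMonoidHom 2 : B →* B).range)
    {r k₀ k : ℕ} (hr : Nat.card {b : B // b ^ 2 = 1} = 2 ^ r) (hr1 : 1 ≤ r) (hk₀ : r ≤ 2 ^ k₀) (hk : k₀ + 1 ≤ k)
    (H₁ H₂ : Subgroup B)
    (hH₁ : ∀ x ∈ H₁, x ^ 2 ^ (Nat.card B).factorization 2 = 1 →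
      ∃ d : B, d ^ 2 ^ (Nat.card B).factorization 2 = 1 ∧ x = (g ^ (2 ^ k)) d / d)
    (hH₂ : ∀ d : B, (g ^ (2 ^ (k + 1))) d / d ∈ H₂) :
    padicValNat 2 (Nat.card H₁) ≤ padicValNat 2 (Nat.card H₂) + (r - 1) := by
  classical
  haveI : Fact (Nat.Prime 2) := ⟨Nat.prime_two⟩
  -- ### the additive model: `V = B`, `Φ = g`, `M = B[2^a]`, `φ = Φ|_M`
  set a : ℕ := (Nat.card B).factorization 2 with hadef
  set Φ : Module.End ℤ (Additive B) := (MonoidHom.toAdditive g.toMonoidHom).toIntLinearMap with hΦdef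
  have hΦapp : ∀ y : B, Φ (Additive.ofMul y) = Additive.ofMul (g y) := fun y => rfl
  have hΦpow : ∀ (i : ℕ) (y : B), (Φ ^ i) (Additive.ofMul y) = Additive.ofMul ((g ^ i) y) := by
    intro i
    induction i with
    | zero => intro y; rw [pow_zero, pow_zero, Module.End.one_apply, MulAut.one_apply]
    | succ i ih => intro y; rw [pow_succ', pow_succ', Module.End.mul_apply, MulAut.mul_apply, ih, hΦapp]
  have hsmul : ∀ (n : ℕ) (y : B), (n : ℤ) • Additive.ofMul y = Additive.ofMul (y ^ n) := fun n y => by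
    rw [← ofMul_zpow, zpow_natCast]
  set M : Submodule ℤ (Additive B) := (Subgroup.toAddSubgroup ((powMonoidHom (2 ^ a) : B →* B).ker)).toIntSubmodule with hMdef
  have hmemM : ∀ y : B, Additive.ofMul y ∈ M ↔ y ^ 2 ^ a = 1 := fun y => Iff.rfl
  have hΦM : ∀ v ∈ M, Φ v ∈ M := fun v hv => by
    have hv' := (hmemM (Additive.toMul v)).mp hv
    change Additive.ofMul (g (Additive.toMul v)) ∈ M
    rw [hmemM, ← map_pow, hv', map_one]
  set φ : Module.End ℤ M := Φ.restrict hΦM with hφdef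
  have hφpow_coe : ∀ (i : ℕ) (m : M), (((φ ^ i) m : M) : Additive B) = (Φ ^ i) (m : Additive B) := fun i m => by
    rw [hφdef, Module.End.pow_restrict, LinearMap.coe_restrict_apply]
  have hY_coe : ∀ (i : ℕ) (m : M), (((φ ^ i - 1) m : M) : Additive B) =
      Additive.ofMul ((g ^ i) (Additive.toMul (m : Additive B)) / Additive.toMul (m : Additive B)) := fun i m => by
    rw [LinearMap.sub_apply, Module.End.one_apply, Submodule.coe_sub, hφpow_coe, ofMul_div]
    exact congrArg (· - (m : Additive B)) (hΦpow i (Additive.toMul (m : Additive B)))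
  -- `#M = 2^a`
  have hMcard : Nat.card M = 2 ^ a := by
    rw [← card_ker_powMonoidHom_eq_pow_factorization (B := B) (p := 2) (k := a) le_rfl]
    exact Nat.card_congr (Equiv.subtypeEquiv Additive.toMul fun _ => Iff.rfl)
  have hM : ∃ a' : ℕ, Nat.card M = 2 ^ a' := ⟨a, hMcard⟩
  -- `φ^{2^t} = 1`
  have hφt : φ ^ (2 ^ t) = 1 := by
    refine LinearMap.ext fun m => Subtype.ext ?_
    rw [hφpow_coe, Module.End.one_apply]
    change (Φ ^ 2 ^ t) (Additive.ofMul (Additive.toMul (m : Additive B))) = _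
    rw [hΦpow, hg, MulAut.one_apply]
    rfl
  -- `a ≥ 1` (since `c` has order `2`) — so `B[2] ⊆ M`
  have hc1 : c ≠ 1 := fun h => hcsq ⟨1, by rw [map_one, h]⟩
  have ha1 : 1 ≤ a := by
    have h2 : 2 ∣ Nat.card B := by
      have hord : orderOf c = 2 := orderOf_eq_prime hc2 hc1
      rw [← hord]; exact orderOf_dvd_natCard c
    exact Nat.Prime.factorization_pos_of_dvd Nat.prime_two Nat.card_pos.ne' h2
  have hmem_of_sq : ∀ y : B, y ^ 2 = 1 → Additive.ofMul y ∈ M := fun y hy => by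
    rw [hmemM]
    obtain ⟨a', ha'⟩ : ∃ a', a = a' + 1 := ⟨a - 1, by omega⟩
    rw [ha', pow_succ, pow_mul', hy, one_pow]
  -- `#(M/2M) = #M[2] = #B[2] = 2^r`
  have hrM : Nat.card (M ⧸ LinearMap.range (((2 : ℕ) : ℤ) • (1 : Module.End ℤ M))) ≤ 2 ^ r := by
    rw [card_quotient_range_smul_eq_card_ker, ← hr]
    refine le_of_eq (Nat.card_congr ?_)
    refine
      { toFun := fun y => ⟨Additive.toMul ((y.1 : M) : Additive B), ?_⟩
        invFun := fun b => ⟨⟨Additive.ofMul b.1, hmem_of_sq b.1 b.2⟩, ?_⟩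
        left_inv := fun y => Subtype.ext (Subtype.ext rfl)
        right_inv := fun b => Subtype.ext rfl }
    · have hy := y.2
      rw [LinearMap.mem_ker, LinearMap.smul_apply, Module.End.one_apply] at hy
      have hy' : (((2 : ℕ) : ℤ) • ((y.1 : M) : Additive B)) = 0 := by
        rw [← Submodule.coe_smul, hy, Submodule.coe_zero]
      change ((2 : ℕ) : ℤ) • Additive.ofMul (Additive.toMul ((y.1 : M) : Additive B)) = Additive.ofMul 1 at hy'
      rw [hsmul] at hy'
      exact Additive.ofMul.injective hy'
    · rw [LinearMap.mem_ker, LinearMap.smul_apply, Module.End.one_apply]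
      apply Subtype.ext
      rw [Submodule.coe_smul, Submodule.coe_zero]
      change ((2 : ℕ) : ℤ) • Additive.ofMul b.1 = Additive.ofMul 1
      rw [hsmul, b.2]
  -- the invariant line `C = ℤ·c ⊆ M`
  set cM : M := ⟨Additive.ofMul c, hmem_of_sq c hc2⟩ with hcMdef
  have hφc : φ cM = cM := by
    apply Subtype.ext
    rw [hφdef, LinearMap.coe_restrict_apply]
    change Φ (Additive.ofMul c) = Additive.ofMul c
    rw [hΦapp, hgc]
  have hC : ∀ v ∈ Submodule.span ℤ {cM}, φ v = v := fun v hv => by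
    obtain ⟨n, rfl⟩ := Submodule.mem_span_singleton.mp hv
    rw [map_zsmul, hφc]
  have hcM : cM ∉ LinearMap.range (((2 : ℕ) : ℤ) • (1 : Module.End ℤ M)) := by
    rintro ⟨y, hy⟩
    rw [LinearMap.smul_apply, Module.End.one_apply] at hy
    apply hcsq
    refine ⟨Additive.toMul ((y : M) : Additive B), ?_⟩
    rw [powMonoidHom_apply]
    have hy' := congrArg (fun m : M => (m : Additive B)) hy
    simp only [Submodule.coe_smul] at hy'
    change ((2 : ℕ) : ℤ) • Additive.ofMul (Additive.toMul ((y : M) : Additive B)) = Additive.ofMul c at hy'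
    rw [hsmul] at hy'
    exact Additive.ofMul.injective hy'
  have hQ : Nat.card (M ⧸ (LinearMap.range (((2 : ℕ) : ℤ) • (1 : Module.End ℤ M)) ⊔ Submodule.span ℤ {cM})) ≤ 2 ^ (r - 1) := by
    have h := card_quotient_sup_span_mul_le (p := 2) hM cM hcM
    have h' : Nat.card (M ⧸ (LinearMap.range (((2 : ℕ) : ℤ) • (1 : Module.End ℤ M)) ⊔ Submodule.span ℤ {cM})) * 2 ≤ 2 ^ (r - 1) * 2 := by
      rw [← pow_succ, Nat.sub_add_cancel hr1]; exact h.trans hrM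
    exact Nat.le_of_mul_le_mul_right h' two_pos
  -- ### Fukuda's step
  have hstep := card_range_pow_sub_one_le_mul (p := 2) hM φ hφt hrM hk₀ hk (Submodule.span ℤ {cM}) hC
  -- ### `#Y_{k+1} ≤ 2^{ord₂ #H₂}`
  have hup : Nat.card (LinearMap.range (φ ^ (2 ^ (k + 1)) - 1)) ≤ 2 ^ padicValNat 2 (Nat.card H₂) := by
    rw [← Nat.factorization_def _ Nat.prime_two, ← card_inf_ker_powMonoidHom_eq (p := 2) (le_refl a) H₂]
    refine Nat.card_le_card_of_injective (fun y => ⟨Additive.toMul ((y.1 : M) : Additive B), ?_⟩) ?_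
    · obtain ⟨m, hm⟩ := y.2
      refine Subgroup.mem_inf.mpr ⟨?_, ?_⟩
      · have : ((y.1 : M) : Additive B) = Additive.ofMul ((g ^ (2 ^ (k + 1))) (Additive.toMul (m : Additive B)) / Additive.toMul (m : Additive B)) := by
          rw [← hm, hY_coe]
        rw [this]
        exact hH₂ _
      · exact (hmemM _).mp (y.1 : M).2
    · intro y₁ y₂ h
      have h' := congrArg (fun z => Additive.ofMul (z.1 : B)) h
      exact Subtype.ext (Subtype.ext h')
  -- ### `2^{ord₂ #H₁} ≤ #Y_k`
  have hlow : 2 ^ padicValNat 2 (Nat.card H₁) ≤ Nat.card (LinearMap.range (φ ^ (2 ^ k) - 1)) := by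
    rw [← Nat.factorization_def _ Nat.prime_two, ← card_inf_ker_powMonoidHom_eq (p := 2) (le_refl a) H₁]
    have hex : ∀ x : ↥(H₁ ⊓ (powMonoidHom (2 ^ a) : B →* B).ker), ∃ d : B, d ^ 2 ^ a = 1 ∧ (x : B) = (g ^ (2 ^ k)) d / d :=
      fun x => hH₁ x.1 (Subgroup.mem_inf.mp x.2).1
        (by have h := (Subgroup.mem_inf.mp x.2).2; rwa [MonoidHom.mem_ker, powMonoidHom_apply] at h)
    choose dd hdd1 hdd2 using hex
    refine Nat.card_le_card_of_injective
      (fun x => ⟨(φ ^ (2 ^ k) - 1 : Module.End ℤ M) ⟨Additive.ofMul (dd x), (hmemM _).mpr (hdd1 x)⟩,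
        LinearMap.mem_range_self (φ ^ (2 ^ k) - 1 : Module.End ℤ M) _⟩) ?_
    intro x₁ x₂ h
    have h' := congrArg (fun z : ↥(LinearMap.range (φ ^ (2 ^ k) - 1)) => Additive.toMul ((z.1 : M) : Additive B)) h
    simp only [hY_coe] at h'
    change (g ^ 2 ^ k) (dd x₁) / dd x₁ = (g ^ 2 ^ k) (dd x₂) / dd x₂ at h'
    rw [← hdd2, ← hdd2] at h'
    exact Subtype.ext h'
  -- ### conclusion
  have h1 : 2 ^ padicValNat 2 (Nat.card H₁) ≤ 2 ^ padicValNat 2 (Nat.card H₂) * 2 ^ (r - 1) :=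
    hlow.trans (hstep.trans (Nat.mul_le_mul hup hQ))
  rw [← pow_add] at h1
  exact (Nat.pow_le_pow_iff_right (by norm_num : 1 < 2)).mp h1

end Literature.NumberTheory.IwasawaTheory.FukudaNakayama

end
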